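import Summits.BirchSwinnertonDyer.BirchSwinnertonDyer.Theorems.PrintCf2RamifiedOffTYZGenusPeriodNonTorsion
import Summits.BirchSwinnertonDyer.BirchSwinnertonDyer.Theorems.PrintCf2RamifiedOffTYZZetaEight
import HarnessLib

/-!
# C⁺ ON THE VISIBLE R2 ROWS ⟺ «`N_{H(i)/M}(x(z) − 2i) ∉ ⟨i⟩·ℍ′²`», GRANTED THEOREM A ALONE — the exact-descent criterion with BOTH auxiliary
# hypotheses (`ζ₈ ∉ ℍ′_n`, `2·Z(n) ≠ 0`) DISCHARGED (crux stmt-BirchSwinnertonDyer-20509 `RamifiedOffTYZOfFacts`, line `offtyz-v7`, LEAD g30, cycle 31, part B3)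

HONEST FRAMING (cell `bsd-print-cf2`, route `PrintCf2`; `--supports stmt-BirchSwinnertonDyer-20509`; theorems only, `def`-free, no `sorry`, no named
fact introduced).  BSD is not proved by any of this; no class is closed by this file; item 23431 (C⁺) and crux 20509 stay OPEN.

g29's ★★★★ `GenusPeriodTraceNorm.levelTwo_iff_not_torsion_and_secondNorm_of_visible_R2_of_facts` (p801252): granted conjuncts 1, 2, 4, 5 of 𝔅_ram and
`tyz_sevenBlockCMData`, on a visible R2 row there is a display package with the norms `N₁ = N_{H/L} x(z_n)`, `N₀ = N_{H(i)/M}(x(z_n) − 2i)` and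
«`[N₁] = 1` → `[i] ≠ 1` → (C⁺ at `lq` ⟺ `2·Z(n) ≠ 0` ∧ `N₀ ∉ ⟨i⟩ℍ′²`)».  This cycle proved `[i] ≠ 1` for every odd `n` (part B1, `ZetaEight.sqClass_im_ne_one`,
from Lemma 3.18) and `Z(lq)` non-torsion on every R2 row with `ord L = 1` (part B2, `GenusPeriodNonTorsion.genusPeriod_not_isOfFinAddOrder_two_primes`).
THIS FILE composes:

* §1 `levelTwo_iff_secondNorm_of_visible_R2` — g29's §4 criterion (p799839) WITHOUT the binder `hi8`.
* §2 ★★★★ `levelTwo_iff_secondNorm_of_visible_R2_of_facts` — conjuncts 1, 2, 4, 5 + `tyz_sevenBlockCMData` ⟹ on every visible R2 row (`ord L(E_{lq}) = 1`,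
  `X(h) ∉ 2ℚ^{×2}`) there are a package `D`, `M ⊇ ℍ′_n`, the CM point `(x₀, y₀)`, `Φ` (`#Φ = g(n)`), and `N₁, N₀ ∈ ℍ′_n` (`ι N₁ = ∏ t x₀`,
  `ι N₀ = ∏ (t x₀ − 2ι(i))`, both `≠ 0`) with the exact-descent identities `κ⁰(Z(n)) = [N₁]`, `κ⁺(Z(n)) = [N₀]` holding OUTRIGHT, `Z(n)` non-torsion,
  `[i] ≠ 1`, and **`[N₁] = 1` ⟹ (C⁺ at `lq` ⟺ neither `N₀` nor `N₀·i` is a square in `ℍ′_n`)** — THEOREM A is the ONLY remaining input.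
* §3 `…_of_bundle` — 𝔅_ram VERBATIM + `tyz_sevenBlockCMData`.
* §4 `levelTwo_iff_normClasses_of_visible_R2_of_facts` — the Theorem-A-free form: C⁺ at `lq` ⟺ the norm PAIR `([N₁],[N₀])` is not a torsion class,
  i.e. `¬ (([N₁] = 1 ∧ [N₀] ∈ {1,[i]}) ∨ ([N₁] = [i] ∧ [N₀] ∈ {[1+i],[i(1+i)]}))` — unconditional inside the bundle + display.

References: [cite: TianYuanZhang2017, §1, §3.1 (p0011 L27–L73), §3.2, Thm. 3.5, Lemma 3.18 (p0017 L152–L153), Thm. 1.2]; [cite: BurungaleFlach2024, Thm 1.1 / Cor. 3];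
[cite: Darmon2004, Thm. 3.22]; [cite: SilvermanAEC2009, Thm. X.1.1, Prop. X.1.4]; [cite: NeukirchSchmidtWingberg2008, §1.5]; tree: p799839, p800776, p801252,
parts B1/B2 of this cycle.
-/

noncomputable section

open scoped Classical

open WeierstrassCurve WeierstrassCurve.Affine WeierstrassCurve.Affine.Point
  Literature.NumberTheory.EllipticCurves Literature.NumberTheory.EllipticCurves.Rank1Residual
  Summit.BirchSwinnertonDyer.Rank1Residual
  Literature.NumberTheory.EllipticCurves.TianYuanZhang2017
  Literature.NumberTheory.EllipticCurves.TianYuanZhang2017.W2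
  Summit.BirchSwinnertonDyer.PrintCf2.VisibleGenerator

set_option autoImplicit false

namespace Summit.BirchSwinnertonDyer.PrintCf2.GenusPeriodSecondNorm

variable {n : ℕ}

open Literature.NumberTheory.EllipticCurves.TianYuanZhang2017.GenusPointData (galPtOver)

/-! ## §1 The criterion of p799839 without `hi8` -/

/-- ★★★ **C⁺ AT `lq` ON A VISIBLE ROW ⟺ THE SECOND NORM IS NOT IN `⟨i⟩·ℍ′²`** — `GenusPeriodExactDescent.levelTwo_iff_secondNorm_of_visible_R2` with the
binder `ζ₈ ∉ ℍ′_n` discharged (Lemma 3.18, part B1).  Granted conjuncts 1, 2, 4, 5; `n = lq` an R2 row with `ord L = 1`; a package `D` (`Printed`, CM layer,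
Thm 3.5 at blocks); a visible generator; the exact-descent identities for `N₁, N₀` with `[N₁] = 1` (THEOREM A).
[cite: TianYuanZhang2017, §1, §3.1, Thm. 3.5, Lemma 3.18, Thm. 1.2] [cite: BurungaleFlach2024, Thm 1.1 / Cor. 3] [cite: Darmon2004, Thm. 3.22] [cite: SilvermanAEC2009, Prop. X.1.4] -/
theorem levelTwo_iff_secondNorm_of_visible_R2 (hGZK : rank_eq_analyticRank_of_analyticRank_le_one)
    (hmod : WeierstrassCurve.hasEntireLFunction_rat) (hCM0 : bsdTriple_of_hasCM_of_L_one_ne_zero) (h12 : thm12_parity_of_scriptL')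
    {l q : ℕ} (hl : l.Prime) (hq : q.Prime) (hl8 : l % 8 = 1) (hq8 : q % 8 = 7) (hn : n = l * q)
    (hr : (congruentNumberCurve n).analyticRank = 1)
    (D : GenusPointData n) (hPr : D.Printed) (hC : D.CMPointCompositumPrinted) (hBl : D.Thm35AtBlocks)
    {X Y : ℚ} (h : (Atwo n).toAffine.Nonsingular X Y) (hX : ¬ ∃ s : ℚ, X = 2 * s ^ 2)
    (hgen : ∀ P : (Atwo n).toAffine.Point, ∃ m : ℤ, IsOfFinAddOrder (P - m • (Point.some X Y h : (Atwo n).toAffine.Point)))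
    {N₁ N₀ : D.H} (hN : N₀ ≠ 0)
    (hED0 : twoDescentComponent (curveA.baseChange D.H).toAffine 0 (2 * D.im) (-(2 * D.im)) (D.Z n) = sqClass N₁)
    (hEDp : twoDescentComponent (curveA.baseChange D.H).toAffine (2 * D.im) 0 (-(2 * D.im)) (D.Z n) = sqClass N₀)
    (hA : sqClass N₁ = 1) :
    (∀ L : ℤ, IsScriptL n L → (2 : ℤ) ∣ L ∧ ¬ (4 : ℤ) ∣ L) ↔ ¬ ((∃ s : D.H, N₀ = s ^ 2) ∨ ∃ s : D.H, N₀ * D.im = s ^ 2) :=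
  GenusPeriodExactDescent.levelTwo_iff_secondNorm_of_visible_R2 hGZK hmod hCM0 h12 hl hq hl8 hq8 hn hr D hPr hC hBl
    (ZetaEight.sqClass_im_ne_one_two_primes (by omega) (by omega) hn D hPr) h hX hgen hN hED0 hEDp hA

/-! ## §2 By name from the display fact: THEOREM A is the only input left -/

/-- ★★★★ **C⁺ ON A VISIBLE R2 ROW ⟺ `N_{H(i)/M}(x(z) − 2i) ∉ ⟨i⟩·ℍ′²` — GRANTED THEOREM A ALONE.**  Conjuncts 1 (GZK), 2 (modularity), 4 (CM rank-zero
BSD), 5 (TYZ Thm 1.2′) of 𝔅_ram + `tyz_sevenBlockCMData`; primes `l ≡ 1`, `q ≡ 7 (mod 8)`, `n = lq`, `ord_{s=1} L(E_n, s) = 1`; a VISIBLE generator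
`h = (X, Y)` of `A_n(ℚ)` modulo torsion (`X ∉ 2ℚ^{×2}`).  Then there are a display package `D` and, in it, `M ⊇ ℍ′_n`, the CM point `(x₀, y₀)`, `Φ`
(`#Φ = g(n)`) and `N₁, N₀ ∈ ℍ′_n` with `ι N₁ = ∏_{t∈Φ} t x₀`, `ι N₀ = ∏_{t∈Φ}(t x₀ − 2ι(i))`, both `≠ 0`, such that: `Z(n)` is NOT torsion, `[i] ≠ 1` in
`ℍ′_n`, the exact-descent identities `κ⁰_{ℍ′}(Z(n)) = [N₁]`, `κ⁺_{ℍ′}(Z(n)) = [N₀]` HOLD, and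
**`[N₁] = 1` ⟹ ( (∀ L, 𝓛(n)² = L² → 2 ∥ L)  ⟺  ¬(N₀ ∈ ℍ′² ∨ N₀·i ∈ ℍ′²) )`.**
[cite: TianYuanZhang2017, §1, §3.1, §3.2, Thm. 3.5, Lemma 3.18, Thm. 1.2] [cite: BurungaleFlach2024, Thm 1.1 / Cor. 3] [cite: Darmon2004, Thm. 3.22]
[cite: SilvermanAEC2009, Thm. X.1.1, Prop. X.1.4] [cite: NeukirchSchmidtWingberg2008, §1.5] -/
theorem levelTwo_iff_secondNorm_of_visible_R2_of_facts (hGZK : rank_eq_analyticRank_of_analyticRank_le_one)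
    (hmod : WeierstrassCurve.hasEntireLFunction_rat) (hCM0 : bsdTriple_of_hasCM_of_L_one_ne_zero) (h12 : thm12_parity_of_scriptL')
    (hT : tyz_sevenBlockCMData)
    {l q : ℕ} (hl : l.Prime) (hq : q.Prime) (hl8 : l % 8 = 1) (hq8 : q % 8 = 7) (hn : n = l * q)
    (hr : (congruentNumberCurve n).analyticRank = 1)
    {X Y : ℚ} (h : (Atwo n).toAffine.Nonsingular X Y) (hX : ¬ ∃ s : ℚ, X = 2 * s ^ 2)
    (hgen : ∀ P : (Atwo n).toAffine.Point, ∃ m : ℤ, IsOfFinAddOrder (P - m • (Point.some X Y h : (Atwo n).toAffine.Point))) :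
    ∃ D : GenusPointData n, D.Printed ∧ D.CMPointCompositumPrinted ∧ D.Thm35AtBlocks ∧
      ∃ (M : Type) (_ : Field M) (_ : NumberField M) (_ : IsGalois ℚ M) (ι : D.H →ₐ[ℚ] M) (x₀ y₀ : M)
        (h₀ : (curveA.baseChange M).toAffine.Nonsingular x₀ y₀) (Φ : Finset (M ≃ₐ[ℚ] M)) (N₁ N₀ : D.H),
        Φ.card = gK n ∧
        Point.map (W' := curveA) ι (D.Z n) = ∑ t ∈ Φ, galPtOver M t (.some x₀ y₀ h₀) ∧
        ι N₁ = ∏ t ∈ Φ, (t : M ≃ₐ[ℚ] M) x₀ ∧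
        ι N₀ = ∏ t ∈ Φ, ((t : M ≃ₐ[ℚ] M) x₀ - 2 * ι D.im) ∧ N₁ ≠ 0 ∧ N₀ ≠ 0 ∧
        ¬ IsOfFinAddOrder (D.Z n) ∧ sqClass D.im ≠ 1 ∧
        twoDescentComponent (curveA.baseChange D.H).toAffine 0 (2 * D.im) (-(2 * D.im)) (D.Z n) = sqClass N₁ ∧
        twoDescentComponent (curveA.baseChange D.H).toAffine (2 * D.im) 0 (-(2 * D.im)) (D.Z n) = sqClass N₀ ∧
        (sqClass N₁ = 1 →
          ((∀ L : ℤ, IsScriptL n L → (2 : ℤ) ∣ L ∧ ¬ (4 : ℤ) ∣ L) ↔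
            ¬ ((∃ s : D.H, N₀ = s ^ 2) ∨ ∃ s : D.H, N₀ * D.im = s ^ 2))) := by
  have hmod8 : n % 8 = 7 := by rw [hn, Nat.mul_mod, hl8, hq8]
  obtain ⟨hsq, -, -⟩ := GenusPeriodNonTorsion.squarefree_and_mod_two_primes hl hq hl8 (Or.inr hq8) hn
  obtain ⟨D, hPr, hC, hBl, hSeven⟩ := hT n hsq (Or.inr (Or.inr hmod8))
  have hZ : ¬ IsOfFinAddOrder (D.Z n) :=
    GenusPeriodNonTorsion.genusPeriod_not_isOfFinAddOrder_two_primes hGZK h12 hl hq hl8 (Or.inr hq8) hn hr D hPr hBl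
  have hZ2 : (2 : ℕ) • D.Z n ≠ 0 := fun h2 => hZ (isOfFinAddOrder_iff_nsmul_eq_zero.mpr ⟨2, two_pos, h2⟩)
  have hi8 : sqClass D.im ≠ 1 := ZetaEight.sqClass_im_ne_one_two_primes (by omega) (by omega) hn D hPr
  obtain ⟨M, iF, iN, iG, ι, x₀, y₀, h₀, Φ, N₁, N₀, hcard, hS1, hN₁, hN₀, hne₁, hne₀, hκ₁, hκ₀⟩ :=
    GenusPeriodTraceNorm.exists_norms_exactDescent D (hSeven n (Nat.mem_divisors_self n hsq.ne_zero) hmod8) hZ2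
  refine ⟨D, hPr, hC, hBl, M, iF, iN, iG, ι, x₀, y₀, h₀, Φ, N₁, N₀, hcard, hS1, hN₁, hN₀, hne₁, hne₀, hZ, hi8, hκ₁, hκ₀, fun hA => ?_⟩
  exact levelTwo_iff_secondNorm_of_visible_R2 hGZK hmod hCM0 h12 hl hq hl8 hq8 hn hr D hPr hC hBl h hX hgen hne₀ hκ₁ hκ₀ hA

/-! ## §3 With 𝔅_ram VERBATIM -/

/-- ★★★★ **𝔅_ram VERBATIM + `tyz_sevenBlockCMData` ⟹ on every visible R2 row, C⁺ at `lq` is «`N₀ ∉ ⟨i⟩·ℍ′²`» granted THEOREM A alone** (`Z(n)` non-torsion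
and `ζ₈ ∉ ℍ′_n` come for free). [cite: TianYuanZhang2017, §1, §3.1, §3.2, Thm. 3.5, Lemma 3.18, Thm. 1.2] [cite: BurungaleFlach2024, Thm 1.1 / Cor. 3]
[cite: Darmon2004, Thm. 3.22] [cite: SilvermanAEC2009, Thm. X.1.1, Prop. X.1.4] [cite: NeukirchSchmidtWingberg2008, §1.5] -/
theorem levelTwo_iff_secondNorm_of_visible_R2_of_bundle
    (hB : (Literature.NumberTheory.EllipticCurves.rank_eq_analyticRank_of_analyticRank_le_one ∧ WeierstrassCurve.hasEntireLFunction_rat ∧ WeierstrassCurve.bsdRHS_eq_of_isIsogenous ∧ Literature.NumberTheory.EllipticCurves.bsdTriple_of_hasCM_of_L_one_ne_zero ∧ Literature.NumberTheory.EllipticCurves.TianYuanZhang2017.thm12_parity_of_scriptL' ∧ Literature.NumberTheory.EllipticCurves.Tian2014.thm13_rank_one_and_sha_odd ∧ Literature.NumberTheory.QuadraticFields.RedeiReichardt.redeiReichardt_fourTwoCard_classGroup ∧ Literature.NumberTheory.EllipticCurves.LiLiuTian2024.thm12_bsd_congruentNumberCurve ∧ Literature.NumberTheory.EllipticCurves.Monsky1990.cor515_rank_eq_one_and_card_selmerGroup_two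 ∧ Literature.NumberTheory.EllipticCurves.HeathBrown1994.monsky_card_selmerGroup_two_even ∧ Literature.NumberTheory.EllipticCurves.Tian2014.tian2014_system_sMinus_genus))
    (hT : tyz_sevenBlockCMData)
    {l q : ℕ} (hl : l.Prime) (hq : q.Prime) (hl8 : l % 8 = 1) (hq8 : q % 8 = 7) (hn : n = l * q)
    (hr : (congruentNumberCurve n).analyticRank = 1)
    {X Y : ℚ} (h : (Atwo n).toAffine.Nonsingular X Y) (hX : ¬ ∃ s : ℚ, X = 2 * s ^ 2)
    (hgen : ∀ P : (Atwo n).toAffine.Point, ∃ m : ℤ, IsOfFinAddOrder (P - m • (Point.some X Y h : (Atwo n).toAffine.Point))) :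
    ∃ D : GenusPointData n, D.Printed ∧ D.CMPointCompositumPrinted ∧ D.Thm35AtBlocks ∧
      ∃ (M : Type) (_ : Field M) (_ : NumberField M) (_ : IsGalois ℚ M) (ι : D.H →ₐ[ℚ] M) (x₀ y₀ : M)
        (h₀ : (curveA.baseChange M).toAffine.Nonsingular x₀ y₀) (Φ : Finset (M ≃ₐ[ℚ] M)) (N₁ N₀ : D.H),
        Φ.card = gK n ∧
        Point.map (W' := curveA) ι (D.Z n) = ∑ t ∈ Φ, galPtOver M t (.some x₀ y₀ h₀) ∧
        ι N₁ = ∏ t ∈ Φ, (t : M ≃ₐ[ℚ] M) x₀ ∧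
        ι N₀ = ∏ t ∈ Φ, ((t : M ≃ₐ[ℚ] M) x₀ - 2 * ι D.im) ∧ N₁ ≠ 0 ∧ N₀ ≠ 0 ∧
        ¬ IsOfFinAddOrder (D.Z n) ∧ sqClass D.im ≠ 1 ∧
        twoDescentComponent (curveA.baseChange D.H).toAffine 0 (2 * D.im) (-(2 * D.im)) (D.Z n) = sqClass N₁ ∧
        twoDescentComponent (curveA.baseChange D.H).toAffine (2 * D.im) 0 (-(2 * D.im)) (D.Z n) = sqClass N₀ ∧
        (sqClass N₁ = 1 →
          ((∀ L : ℤ, IsScriptL n L → (2 : ℤ) ∣ L ∧ ¬ (4 : ℤ) ∣ L) ↔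
            ¬ ((∃ s : D.H, N₀ = s ^ 2) ∨ ∃ s : D.H, N₀ * D.im = s ^ 2))) :=
  levelTwo_iff_secondNorm_of_visible_R2_of_facts hB.1 hB.2.1 hB.2.2.2.1 hB.2.2.2.2.1 hT hl hq hl8 hq8 hn hr h hX hgen

/-! ## §4 Without Theorem A: C⁺ at `lq` ⟺ the norm pair `([N₁], [N₀])` is not a torsion class -/

/-- ★★★ **THEOREM-A-FREE FORM.**  Same hypotheses as §2 (conjuncts 1, 2, 4, 5 + `tyz_sevenBlockCMData`, visible R2 row): there are `D` and `N₁, N₀` as there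
with **C⁺ at `lq` ⟺ ¬( ([N₁] = 1 ∧ ([N₀] = 1 ∨ [N₀] = [i])) ∨ ([N₁] = [i] ∧ ([N₀] = [1+i] ∨ [N₀] = [i(1+i)])) )** — the complete `2`-descent image of
`A[(1+i)³] = A(ℍ′_n)_tor` — unconditional inside the bundle + display.  THEOREM A (`[N₁] = 1`) kills the second disjunct.
[cite: TianYuanZhang2017, §1, §3.1, §3.2, Thm. 3.5, Lemma 3.18, Thm. 1.2] [cite: BurungaleFlach2024, Thm 1.1 / Cor. 3] [cite: Darmon2004, Thm. 3.22]
[cite: SilvermanAEC2009, Thm. X.1.1, Prop. X.1.4] [cite: NeukirchSchmidtWingberg2008, §1.5] -/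
theorem levelTwo_iff_normClasses_of_visible_R2_of_facts (hGZK : rank_eq_analyticRank_of_analyticRank_le_one)
    (hmod : WeierstrassCurve.hasEntireLFunction_rat) (hCM0 : bsdTriple_of_hasCM_of_L_one_ne_zero) (h12 : thm12_parity_of_scriptL')
    (hT : tyz_sevenBlockCMData)
    {l q : ℕ} (hl : l.Prime) (hq : q.Prime) (hl8 : l % 8 = 1) (hq8 : q % 8 = 7) (hn : n = l * q)
    (hr : (congruentNumberCurve n).analyticRank = 1)
    {X Y : ℚ} (h : (Atwo n).toAffine.Nonsingular X Y) (hX : ¬ ∃ s : ℚ, X = 2 * s ^ 2)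
    (hgen : ∀ P : (Atwo n).toAffine.Point, ∃ m : ℤ, IsOfFinAddOrder (P - m • (Point.some X Y h : (Atwo n).toAffine.Point))) :
    ∃ D : GenusPointData n, D.Printed ∧ D.CMPointCompositumPrinted ∧ D.Thm35AtBlocks ∧
      ∃ (M : Type) (_ : Field M) (_ : NumberField M) (_ : IsGalois ℚ M) (ι : D.H →ₐ[ℚ] M) (x₀ y₀ : M)
        (h₀ : (curveA.baseChange M).toAffine.Nonsingular x₀ y₀) (Φ : Finset (M ≃ₐ[ℚ] M)) (N₁ N₀ : D.H),
        Φ.card = gK n ∧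
        Point.map (W' := curveA) ι (D.Z n) = ∑ t ∈ Φ, galPtOver M t (.some x₀ y₀ h₀) ∧
        ι N₁ = ∏ t ∈ Φ, (t : M ≃ₐ[ℚ] M) x₀ ∧
        ι N₀ = ∏ t ∈ Φ, ((t : M ≃ₐ[ℚ] M) x₀ - 2 * ι D.im) ∧ N₁ ≠ 0 ∧ N₀ ≠ 0 ∧
        ((∀ L : ℤ, IsScriptL n L → (2 : ℤ) ∣ L ∧ ¬ (4 : ℤ) ∣ L) ↔
          ¬ ((sqClass N₁ = 1 ∧ (sqClass N₀ = 1 ∨ sqClass N₀ = sqClass D.im)) ∨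
              (sqClass N₁ = sqClass D.im ∧ (sqClass N₀ = sqClass (1 + D.im) ∨ sqClass N₀ = sqClass (D.im * (1 + D.im)))))) := by
  have hodd : Odd n := by
    rw [hn, Nat.odd_mul]; exact ⟨Nat.odd_iff.mpr (by omega), Nat.odd_iff.mpr (by omega)⟩
  obtain ⟨D, hPr, hC, hBl, M, iF, iN, iG, ι, x₀, y₀, h₀, Φ, N₁, N₀, hcard, hS1, hN₁, hN₀, hne₁, hne₀, -, -, hκ₁, hκ₀, -⟩ :=
    levelTwo_iff_secondNorm_of_visible_R2_of_facts hGZK hmod hCM0 h12 hT hl hq hl8 hq8 hn hr h hX hgen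
  refine ⟨D, hPr, hC, hBl, M, iF, iN, iG, ι, x₀, y₀, h₀, Φ, N₁, N₀, hcard, hS1, hN₁, hN₀, hne₁, hne₀, ?_⟩
  rw [GenusPeriodR2.levelTwo_iff_genusPeriod_not_twoDivisible_of_visible hGZK hmod hCM0 h12 hl hq hl8 hq8 hn hr D hPr hC hBl h hX hgen,
    GenusPeriodExactDescent.twoDivisible_iff_normClasses D hodd hPr.2.2.2.2.2.2.2.2.1 hκ₁ hκ₀]

end Summit.BirchSwinnertonDyer.PrintCf2.GenusPeriodSecondNorm

end
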